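import Summits.QuantumAdvantage.QuantumAdvantage.Theses.SpinorFlattening
import Literature.Computability.QuantumComplexity.GaussianRank

/-!
# Negative lemmas III-a: explicit action of Jordan–Wigner Majoranas on amplitudes; last-block register splitting

Disprover's support file for crux `SpinorFlattening.GaussRankPolyImpliesPPoly` (stmt-QuantumAdvantage-1247),
refuter-cdisprove-stmt-QuantumAdvantage-1247-g2-0 (gen 2, 2026-08-16); work file `Cruxes/GaussRankPolyImpliesPPoly/Disproof.lean`.
Part of the in-tree proof of the Gaussian fidelity bound `F_𝒢(M^{⊗t}) ≤ 2^{-t}` (CudbyStrelchuk2023 Lemma 3)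
from the annihilator definition `IsGaussian` (files MajoranaAction → MajoranaCAR → QuadraticRelations →
CornerLemma → GaussianFidelity). Sorry-free; nothing here asserts a Theses statement.

THIS FILE (the only one with definitions): `majPhase` (the phase of `c_{j,β}` at a label) and
`majorana_mulVec_apply` (`(c_{j,β} G)(y) = majPhase j β y · G(flip_j y)`); the last-block splitting
`QReg (b+4) = QReg b ++ QReg 4`: `cond4 G x = G(·, x)`, the left parity sign `bsign`, `normSq_eq_sum_cond4`,
how left-half / last-block Majoranas act on appended labels (`majorana_castAdd_mulVec_append`,
`majorana_natAdd_mulVec_append`), and HEREDITY of the quadratic relations under conditioning on the last block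
(`quadRel_cond4`); the corner strings `s0000, s1111, s1000, s0111`, the flip tables `fA, fB` and the
coefficients `theta` of the corner relation.
-/

set_option linter.dupNamespace false

noncomputable section

namespace Summit.QuantumAdvantage.QuantumAdvantage.Theorems.GaussRankPolyImpliesPPoly.Negative

open Literature.Computability.Cryptography Literature.Computability.QuantumComplexity
open Matrix

/-- The Jordan–Wigner phase of `c_{j,β}` at the basis label `y`. [folklore] -/
def majPhase {n : ℕ} (j : Fin n) (β : Bool) (y : QReg n) : ℂ :=
  (if β then (if y j then Complex.I else -Complex.I) else 1) *
    ∏ i : Fin n, (if i < j ∧ y i = true then (-1 : ℂ) else 1)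

/-- `‖majPhase‖ = 1`. [folklore] -/
theorem norm_majPhase {n : ℕ} (j : Fin n) (β : Bool) (y : QReg n) : ‖majPhase j β y‖ = 1 := by
  unfold majPhase
  rw [norm_mul, norm_prod]
  have h1 : ‖(if β then (if y j then Complex.I else -Complex.I) else (1 : ℂ))‖ = 1 := by
    split_ifs <;> simp
  have h2 : ∀ i : Fin n, ‖(if i < j ∧ y i = true then (-1 : ℂ) else 1)‖ = 1 := by
    intro i; split_ifs <;> simp
  rw [h1, one_mul]
  exact Finset.prod_eq_one fun i _ => h2 i

/-- `majPhase j false y ^ 2 + majPhase j true y ^ 2 = 0` (the `X` and `Y` phases differ by `± i`).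
[folklore] -/
theorem majPhase_sq_add {n : ℕ} (j : Fin n) (y : QReg n) :
    majPhase j false y ^ 2 + majPhase j true y ^ 2 = 0 := by
  unfold majPhase
  set P := ∏ i : Fin n, (if i < j ∧ y i = true then (-1 : ℂ) else 1)
  cases y j <;> simp [mul_pow, Complex.I_sq]

/-- **Action of a Majorana on amplitudes**: `(c_{j,β} G)(y) = majPhase j β y · G(flip_j y)`. [folklore] -/
theorem majorana_mulVec_apply {n : ℕ} (j : Fin n) (β : Bool) (G : QReg n → ℂ) (y : QReg n) :
    (majorana n j β *ᵥ G) y = majPhase j β y * G (Function.update y j (!y j)) := by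
  classical
  rw [Matrix.mulVec, dotProduct, Finset.sum_eq_single (Function.update y j (!y j))]
  · rw [majorana_apply, majPhase]
    congr 1
    have hj : Function.update y j (!y j) j = !y j := Function.update_self _ _ _
    rw [hj]
    have hfac : (if β then Pauli.Y else Pauli.X).mat (y j) (!y j) =
        (if β then (if y j then Complex.I else -Complex.I) else 1) := by
      cases β <;> cases y j <;> simp
    rw [hfac]
    congr 1
    rw [← Finset.mul_prod_erase Finset.univ _ (Finset.mem_univ j)]
    have hjj : (if j < j ∧ y j = true then (-1 : ℂ) else 1) = 1 := by simp
    rw [hjj, one_mul]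
    refine Finset.prod_congr rfl fun i hi => ?_
    have hij : i ≠ j := Finset.ne_of_mem_erase hi
    rw [Function.update_of_ne hij]
    by_cases hlt : i < j
    · simp only [Pauli.mat_Z_apply, if_true, hlt, true_and]
    · simp only [Pauli.mat_I_apply, if_true, hlt, false_and, if_false]
  · intro x _ hx
    rw [majorana_apply]
    by_cases hxj : x j = y j
    · have : (if β then Pauli.Y else Pauli.X).mat (y j) (x j) = 0 := by
        rw [hxj]; cases β <;> simp
      rw [this, zero_mul, zero_mul]
    · have hex : ∃ i, i ≠ j ∧ x i ≠ y i := by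
        by_contra hno
        push Not at hno
        apply hx
        funext i
        by_cases hi : i = j
        · subst hi
          rw [Function.update_self]
          cases hxi : x i <;> cases hyi : y i <;> simp_all
        · rw [Function.update_of_ne hi]
          exact hno i hi
      obtain ⟨i, hij, hxy⟩ := hex
      have hzero : (if i < j then Pauli.Z else Pauli.I).mat (y i) (x i) = 0 := by
        have : y i ≠ x i := fun h => hxy h.symm
        split_ifs <;> simp [this]
      rw [Finset.prod_eq_zero (Finset.mem_erase.2 ⟨hij, Finset.mem_univ i⟩) hzero, mul_zero, zero_mul]
  · intro h; exact absurd (Finset.mem_univ _) h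

/-- Conditional amplitude vector on the first `b` wires given the last-block label `x`. [folklore] -/
def cond4 {b : ℕ} (G : QReg (b + 4) → ℂ) (x : QReg 4) : QReg b → ℂ := fun w => G (Fin.append w x)

/-- The parity sign `(-1)^{|w|}` of the first `b` wires (the Jordan–Wigner string through them). [folklore] -/
def bsign {b : ℕ} (w : QReg b) : ℂ := ∏ i : Fin b, (if w i = true then (-1 : ℂ) else 1)

/-- `bsign w ^ 2 = 1`. [folklore] -/
theorem bsign_sq {b : ℕ} (w : QReg b) : bsign w * bsign w = 1 := by
  unfold bsign
  rw [← Finset.prod_mul_distrib]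
  exact Finset.prod_eq_one fun i _ => by split_ifs <;> norm_num

/-- `star (bsign w) = bsign w` (a real sign). [folklore] -/
theorem star_bsign {b : ℕ} (w : QReg b) : star (bsign w) = bsign w := by
  unfold bsign
  rw [Complex.star_def, map_prod]
  refine Finset.prod_congr rfl fun i _ => ?_
  split_ifs <;> simp

/-- `‖bsign w‖ = 1`. [folklore] -/
theorem norm_bsign {b : ℕ} (w : QReg b) : ‖bsign w‖ = 1 := by
  unfold bsign
  rw [norm_prod]
  exact Finset.prod_eq_one fun i _ => by split_ifs <;> simp

/-- Twisting by the parity sign does not change the norm. [folklore] -/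
theorem normSq_bsign_mul {b : ℕ} (f : QReg b → ℂ) : normSq (fun w => bsign w * f w) = normSq f := by
  unfold normSq
  refine Finset.sum_congr rfl fun w _ => ?_
  rw [norm_mul, norm_bsign, one_mul]

/-- `0 ≤ normSq`. [folklore] -/
theorem normSq_nonneg' {n : ℕ} (ψ : QReg n → ℂ) : 0 ≤ normSq ψ :=
  Finset.sum_nonneg fun _ _ => by positivity

/-- **`‖G‖² = Σ_x ‖cond4 G x‖²`**. [folklore] -/
theorem normSq_eq_sum_cond4 {b : ℕ} (G : QReg (b + 4) → ℂ) :
    normSq G = ∑ x : QReg 4, normSq (cond4 G x) := by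
  unfold normSq cond4
  rw [← Fintype.sum_equiv (Fin.appendEquiv b 4) (fun p => ‖G (Fin.append p.1 p.2)‖ ^ 2)
    (fun z => ‖G z‖ ^ 2) (fun p => rfl), Fintype.sum_prod_type, Finset.sum_comm]

/-- Updating an appended tuple at a left index. [folklore] -/
theorem update_append_castAdd {b : ℕ} (w : QReg b) (x : QReg 4) (i : Fin b) (c : Bool) :
    Function.update (Fin.append w x) (Fin.castAdd 4 i) c = Fin.append (Function.update w i c) x := by
  funext m
  cases m using Fin.addCases with
  | left i' =>
    rw [Fin.append_left]
    by_cases h : i' = i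
    · subst h
      rw [Function.update_self, Function.update_self]
    · rw [Function.update_of_ne (fun h' => h (Fin.castAdd_inj.1 h')), Fin.append_left,
        Function.update_of_ne h]
  | right k =>
    have hne : (Fin.natAdd b k : Fin (b + 4)) ≠ Fin.castAdd 4 i := by
      intro h'; have := congrArg Fin.val h'; simp at this; omega
    rw [Function.update_of_ne hne, Fin.append_right, Fin.append_right]

/-- Updating an appended tuple at a right index. [folklore] -/
theorem update_append_natAdd {b : ℕ} (w : QReg b) (x : QReg 4) (k : Fin 4) (c : Bool) :
    Function.update (Fin.append w x) (Fin.natAdd b k) c = Fin.append w (Function.update x k c) := by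
  funext m
  cases m using Fin.addCases with
  | left i' =>
    have hne : (Fin.castAdd 4 i' : Fin (b + 4)) ≠ Fin.natAdd b k := by
      intro h'; have := congrArg Fin.val h'; simp at this; omega
    rw [Function.update_of_ne hne, Fin.append_left, Fin.append_left]
  | right k' =>
    rw [Fin.append_right]
    by_cases h : k' = k
    · subst h
      rw [Function.update_self, Function.update_self]
    · have hne : (Fin.natAdd b k' : Fin (b + 4)) ≠ Fin.natAdd b k := by
        intro h'; apply h; have := congrArg Fin.val h'; simp at this; exact Fin.ext (by omega)
      rw [Function.update_of_ne hne, Fin.append_right, Function.update_of_ne h]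

/-- Phase of a left-half Majorana on an appended label: independent of the last block. [folklore] -/
theorem majPhase_castAdd {b : ℕ} (i : Fin b) (β : Bool) (w : QReg b) (x : QReg 4) :
    majPhase (Fin.castAdd 4 i) β (Fin.append w x) = majPhase i β w := by
  unfold majPhase
  rw [Fin.append_left, Fin.prod_univ_add]
  have h2 : ∏ k : Fin 4, (if (Fin.natAdd b k : Fin (b + 4)) < Fin.castAdd 4 i ∧
      Fin.append w x (Fin.natAdd b k) = true then (-1 : ℂ) else 1) = 1 := by
    refine Finset.prod_eq_one fun k _ => ?_
    have : ¬ ((Fin.natAdd b k : Fin (b + 4)) < Fin.castAdd 4 i) := by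
      rw [Fin.lt_def]; simp; omega
    simp [this]
  rw [h2, mul_one]
  congr 1
  refine Finset.prod_congr rfl fun i' _ => ?_
  rw [Fin.append_left]
  have : ((Fin.castAdd 4 i' : Fin (b + 4)) < Fin.castAdd 4 i) ↔ i' < i := by
    rw [Fin.lt_def, Fin.lt_def]; simp
  simp only [this]

/-- Phase of a last-block Majorana on an appended label: the parity sign of the left half times the
four-qubit phase. [folklore] -/
theorem majPhase_natAdd {b : ℕ} (k : Fin 4) (β : Bool) (w : QReg b) (x : QReg 4) :
    majPhase (Fin.natAdd b k) β (Fin.append w x) = bsign w * majPhase k β x := by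
  unfold majPhase bsign
  rw [Fin.append_right, Fin.prod_univ_add]
  have h1 : ∏ i' : Fin b, (if (Fin.castAdd 4 i' : Fin (b + 4)) < Fin.natAdd b k ∧
      Fin.append w x (Fin.castAdd 4 i') = true then (-1 : ℂ) else 1) =
      ∏ i' : Fin b, (if w i' = true then (-1 : ℂ) else 1) := by
    refine Finset.prod_congr rfl fun i' _ => ?_
    have : (Fin.castAdd 4 i' : Fin (b + 4)) < Fin.natAdd b k := by
      rw [Fin.lt_def]; simp; omega
    rw [Fin.append_left]; simp [this]
  have h2 : ∏ k' : Fin 4, (if (Fin.natAdd b k' : Fin (b + 4)) < Fin.natAdd b k ∧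
      Fin.append w x (Fin.natAdd b k') = true then (-1 : ℂ) else 1) =
      ∏ k' : Fin 4, (if k' < k ∧ x k' = true then (-1 : ℂ) else 1) := by
    refine Finset.prod_congr rfl fun k' _ => ?_
    rw [Fin.append_right]
    have : ((Fin.natAdd b k' : Fin (b + 4)) < Fin.natAdd b k) ↔ k' < k := Fin.natAdd_lt_natAdd_iff b
    simp only [this]
  rw [h1, h2]
  ring

/-- **A left-half Majorana acts on the conditional vector.** [folklore] -/
theorem majorana_castAdd_mulVec_append {b : ℕ} (G : QReg (b + 4) → ℂ) (i : Fin b) (β : Bool)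
    (w : QReg b) (x : QReg 4) :
    (majorana (b + 4) (Fin.castAdd 4 i) β *ᵥ G) (Fin.append w x) = (majorana b i β *ᵥ cond4 G x) w := by
  rw [majorana_mulVec_apply, majorana_mulVec_apply, majPhase_castAdd, Fin.append_left,
    update_append_castAdd]
  rfl

/-- **A last-block Majorana acts on the four-qubit slice, up to the left parity sign.** [folklore] -/
theorem majorana_natAdd_mulVec_append {b : ℕ} (G : QReg (b + 4) → ℂ) (k : Fin 4) (β : Bool)
    (w : QReg b) (x : QReg 4) :
    (majorana (b + 4) (Fin.natAdd b k) β *ᵥ G) (Fin.append w x) =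
      bsign w * (majorana 4 k β *ᵥ (fun x' => G (Fin.append w x'))) x := by
  rw [majorana_mulVec_apply, majorana_mulVec_apply, majPhase_natAdd, Fin.append_right,
    update_append_natAdd, mul_assoc]

/-- Splitting the sum over the Majoranas of `b + 4` wires into the two halves. [folklore] -/
theorem sum_majorana_split {b : ℕ} (f : Fin (b + 4) × Bool → ℂ) :
    ∑ p : Fin (b + 4) × Bool, f p =
      (∑ q : Fin b × Bool, f (Fin.castAdd 4 q.1, q.2)) + ∑ r : Fin 4 × Bool, f (Fin.natAdd b r.1, r.2) := by
  simp only [Fintype.sum_prod_type]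
  exact Fin.sum_univ_add _

/-- **Heredity**: the quadratic relations pass to every last-block conditional (the last-block terms of the
relation at two labels with the SAME last block cancel in `X`/`Y` pairs). [folklore] -/
theorem quadRel_cond4 {b : ℕ} {G : QReg (b + 4) → ℂ}
    (hG : (∀ u v : QReg (b + 4), ∑ p : Fin (b + 4) × Bool, (majorana (b + 4) p.1 p.2 *ᵥ G) u * (majorana (b + 4) p.1 p.2 *ᵥ G) v = 0)) (x : QReg 4) :
    (∀ u v : QReg b, ∑ p : Fin b × Bool, (majorana b p.1 p.2 *ᵥ cond4 G x) u * (majorana b p.1 p.2 *ᵥ cond4 G x) v = 0) := by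
  intro w w'
  have h := hG (Fin.append w x) (Fin.append w' x)
  rw [sum_majorana_split] at h
  simp only [majorana_castAdd_mulVec_append, majorana_natAdd_mulVec_append] at h
  have hA : ∑ r : Fin 4 × Bool, bsign w * (majorana 4 r.1 r.2 *ᵥ fun x' => G (Fin.append w x')) x *
      (bsign w' * (majorana 4 r.1 r.2 *ᵥ fun x' => G (Fin.append w' x')) x) = 0 := by
    rw [Fintype.sum_prod_type]
    refine Finset.sum_eq_zero fun k _ => ?_
    simp only [Fintype.sum_bool, majorana_mulVec_apply]
    have := majPhase_sq_add k x
    linear_combination (bsign w * bsign w' * G (Fin.append w (Function.update x k (!x k))) *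
      G (Fin.append w' (Function.update x k (!x k)))) * this
  rw [hA, add_zero] at h
  exact h

/-- Bit strings of the last block. [folklore] -/
def s0000 : QReg 4 := fun _ => false

/-- [folklore] -/
def s1111 : QReg 4 := fun _ => true

/-- [folklore] -/
def s1000 : QReg 4 := ![true, false, false, false]

/-- [folklore] -/
def s0111 : QReg 4 := ![false, true, true, true]

/-- The flips of `1000` at position `k`: `0000, 1100, 1010, 1001`. [folklore] -/
def fA : Fin 4 → QReg 4 := ![s0000, ![true, true, false, false], ![true, false, true, false], ![true, false, false, true]]

/-- The flips of `0111` at position `k`: `1111, 0011, 0101, 0110` (complements of `fA k`). [folklore] -/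
def fB : Fin 4 → QReg 4 := ![s1111, ![false, false, true, true], ![false, true, false, true], ![false, true, true, false]]

/-- [folklore] -/
theorem update_s1000 (k : Fin 4) : Function.update s1000 k (!s1000 k) = fA k := by
  fin_cases k <;> decide

/-- [folklore] -/
theorem update_s0111 (k : Fin 4) : Function.update s0111 k (!s0111 k) = fB k := by
  fin_cases k <;> decide

/-- The coefficients of the last-block part of the relation: `θ_k = Σ_β majPhase k β 1000 · majPhase k β 0111`.
[folklore] -/
def theta (k : Fin 4) : ℂ :=
  majPhase k false s1000 * majPhase k false s0111 + majPhase k true s1000 * majPhase k true s0111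

/-- `θ_0 = 2`. [folklore] -/
theorem theta_zero : theta 0 = 2 := by
  simp [theta, majPhase, s1000, s0111]
  norm_num

/-- `‖θ_k‖ ≤ 2`. [folklore] -/
theorem norm_theta_le (k : Fin 4) : ‖theta k‖ ≤ 2 := by
  unfold theta
  refine (norm_add_le _ _).trans ?_
  rw [norm_mul, norm_mul, norm_majPhase, norm_majPhase, norm_majPhase, norm_majPhase]
  norm_num

end Summit.QuantumAdvantage.QuantumAdvantage.Theorems.GaussRankPolyImpliesPPoly.Negative
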